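import Summits.QuantumFields.YangMills.Theorems.BalabanUVNodesK1RunRowsOfBoxAndPartialSums

/-!
# K1⁷ v6 — THE TWO REGISTERED STUB TEXTS' PREDICATES AS TREE DEFINITIONS (so that stub proofs and suppliers can be filed BY NAME), the `Iff.rfl` bridges, and the by-name composition

Cell `pub-ymgap`, WIDTH SEAT `pub-ymgap-dag-n24-w1` (gen 2; director-ym №197 ∕ HUMAN RULING D-0149).  `--kind definition --supports stmt-QuantumFields-20542 --as helper` (count-neutral).
Precedent and pattern: k0-s2-w1's `Thm/BalabanUVNodesK0V19Defs.lean` for K0⁷ V19 (the mirror that let `K0V19Stub2Prime.stub_prop6MemberB8AtP13` land BY NAME, p595104).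
[I] = [Balaban1987RG1]; [II] = [Balaban1988RG2Cluster]; [III] = [Balaban1988Convergent]; [V] = [Balaban1989LargeFieldII]; [16] = [Balaban1985UV3]; [IV] = [Balaban1989LargeFieldI].

WHY.  Plan g82 registered skeleton v6 on K1⁷ stmt-QuantumFields-20542 (`[K1V6-REGISTERED]`, 2026-08-28 03:16:54Z; file `HOME/pub-ymgap-plan/D82-K1V6/K1Skeleton13SepCoPHv6.lean`
03f66ac9cc89391f, ns `…Theses.BalabanUVNodes.K1Skeleton13SepCoPHV6`): stubs `stub_nodes13PWS : ∀ F : T4Family, Inhabited13 F → NodesAtSomeRecord13PWS F` (v5 VERBATIM) and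
`stub_runRows13PWS : ∀ F : T4Family, NodesAtSomeRecord13PWS F → RunRowsAtSomeRecord13PWS F` (RUN CURRENCY; its rows are EXACTLY the inputs of this seat's
`K1EndOfNodes13PWSOfRunRemAt.stabilityB_body_of_rung1At_of_runLetters`, p598782 §2, which the skeleton imports and composes BY NAME).  The gate credits a `--supports 20542` proof only
if it proves a registered stub BY NAME with that VERBATIM header; the predicates are `def`s LOCAL to the skeleton file (plan's HOME, never imported — the tree stays sorry-free), so no tree
file can spell `NodesAtSomeRecord13PWS F` or `RunRowsAtSomeRecord13PWS F`.  THIS FILE (importing this seat's `…K1RunRowsOfBoxAndPartialSums` p602861, whence p598782 and DEF-1's run edition) puts the predicate texts into the tree BYTE-FOR-BYTE as in v6 (`RecordS` l.93–96, `Inhabited13`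
l.110–111, `NodesAtSomeRecord13PWS` l.118–122, `Window` l.125–126 with the skeleton's `abbrev SU2` inlined, `BetaWindowAtSomeRecord13S` l.129–132 (v5 annex), `RunRowsAtSomeRecord13PWS`
l.155–160), for every K1⁷ lane to import: stub 1 = the thirteen-node lanes (n05–n13) + the N24 engine (dag-n24-c), stub 2″ = NODE O ∕ ym-nodeO DEF-1's run letters + the β sub-cell's (D1)
drift (through the adapter below) or any run-wise two-sided bound with a non-negative floor (this seat's `K1RunRowsOfBoxAndPartialSums`).  §2 gives the `Iff.rfl` bridges to the tree's
objects (dag-n10-d's S-class `Node00.IsRecordOfRecord₁₃CSepCoPHS`; the route decl itself) and composes K1⁷ BY NAME from the two texts exactly as the skeleton's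
`StabilityBAtRecordR13SepCoPH_ofRunRows` ∕ `_proof` do; §3 is the skeleton's displayed adapter from K2⁷ v6's run letter, over the named predicate.

CONTENTS.  §1 `RecordS`, `Inhabited13`, `NodesAtSomeRecord13PWS`, `Window`, `BetaWindowAtSomeRecord13S`, `RunRowsAtSomeRecord13PWS` (v6 texts VERBATIM; docstrings = the skeleton's,
abridged).  §2 `recordS_iff_isRecordOfRecord₁₃CSepCoPHS` (`Iff.rfl`) · `stabilityBAtRecordR13SepCoPH_iff` (K1⁷ ⟺ `∀ F, Inhabited13 F → ∃ θ h, … ∧ Window …`, `Iff.rfl`) ·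
`stabilityBAtRecordR13SepCoPH_of_stubTexts` (the two v6 texts ⟹ K1⁷ BY NAME; = the skeleton's composition) · `stabilityBAtRecordR13SepCoPH_of_stubTexts_v5annex` (stub 1 + v5's rung-2
text ⟹ K1⁷, through dag-n10-d's `endStatementBPrinted_of_isRecordOfRecord₁₃CSepCoPHS_of_nodes`) · `runRowsAtSomeRecord13PWS_of_betaWindowAtSomeRecord13S` + `stub_runRows13PWS_of_stub_betaWindow13PWS` (v5's rung-2 ∕
stub-2 TEXT ⟹ v6's rung-2″ ∕ stub-2″ TEXT BY NAME, via p602861's `runRowsAt_of_rung2At`).  §3 `runRowsAtSomeRecord13PWS_of_runRemAt_drift_match` (the skeleton's adapter l.174–184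
VERBATIM over the named predicate).

HONEST FRAMING.  Definitions, two `Iff.rfl`s, two by-name compositions, the v5 ⟹ v6 bridge by name and one adapter; NOTHING of Bałaban asserted; no stub is proved here; K1⁷ stmt-QuantumFields-20542 OPEN, unclaimed;
the skeleton of record is the plan's v6 (this file neither replaces nor re-registers it — it mirrors its texts so that proofs can be filed by name; if the plan re-cuts, this file is
superseded, not edited).  Counts unmoved (typed 28∕28 · discharged 5∕27).  One finite 𝕋⁴ programme at fixed `ε = L^{−K}`, Bałaban AS PRINTED — NOT continuum ∕ ℝ⁴ ∕ OS ∕ mass gap ∕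
Clay: the Yang–Mills mass gap is NOT proved by any of this; route R4 closes the CONDITIONAL finite-𝕋⁴ rung `BalabanLadder.UV` only.  No `sorry`, `instance`, `notation`; standard axioms.
-/

noncomputable section

open scoped Matrix.Norms.L2Operator

namespace Summit.QuantumFields.YangMills.Theorems.K1V6Defs

open Literature.MathematicalPhysics.QuantumFieldTheory.Balaban1983to89
open Literature.MathematicalPhysics.QuantumFieldTheory.Balaban1983to89.T4Continuum
open Literature.MathematicalPhysics.QuantumFieldTheory.Balaban1983to89.DagBinding
open FlowStepRuns
open FlowStep (HBeta RGEqH prefixOf)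
open Summit.QuantumFields.YangMills.Theorems.BalabanUVNodesK2NamedJetsRunRemAt (RunRemAt RunConstRemainder runwisePS_of_drift_runConstRemainder)
open Summit.QuantumFields.YangMills.Theorems.BalabanUVNodesK2NamedJetsRemAt (band_of_drift)
open Summit.QuantumFields.YangMills.Theorems.BalabanUVNodesK2JsOfRecord (StepColourData beta0OfJs)
open Literature.MathematicalPhysics.QuantumFieldTheory.Balaban1983to89.Beta.Drift (OneLoopDrift)
open Summit.QuantumFields.YangMills.Theorems.EndpointGivenBR13SepCoPH.Negative.RemNamedJets13FalseOfTwoNormalisations (oneLoopDrift_const_mul)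
open Summit.QuantumFields.YangMills.BalabanUVNodes.K1EndOfNodes13PWSOfRunRemAt (stabilityB_body_of_rung1At_of_runLetters)
open Summit.QuantumFields.YangMills.BalabanUVNodes.K1RunRowsOfBoxAndPartialSums (runRowsAt_of_rung2At)

/-! ## §1 The v6 predicate texts, verbatim -/

/-- **THE S-BOUND RECORD CLASS AT THE PRESENTING PAIR** (v6 l.93–96 VERBATIM; tree twin = dag-n10-d's `Node00.IsRecordOfRecord₁₃CSepCoPHS`, `Iff.rfl` in §2): def-T's `IsRecordOfRecord₁₃CSepCoPH`
with `upOfRecord₅C ↦ upOfRecord₅CS` — SOME admissible separated-range parameter `θ'` presenting the SAME datum, the world bound to its construction, window `0 < w.γ ≤ θ'.γ`, block size, and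
the S-BINDING of record over its Stage-13 view. [cite: Balaban1989LargeFieldII, Thm 1 + (0.1) pp.355–356; Balaban1985RegularSpaces, Thm 8 (1.146) p.101 (objects of record; bookkeeping)] -/
def RecordS (F : T4Family) (θ : Node00.Stage13HParams F 2) (h : θ.Provisos₁₃SepCoPH F 2) (w : WorldP) : Prop :=
  ∃ (θ' : Node00.Stage13HParams F 2) (h' : θ'.Provisos₁₃SepCoPH F 2), θ'.Admissible F 2 ∧
    Node00.datumOfRecord₁₃SepCoPH F 2 θ h = Node00.datumOfRecord₁₃SepCoPH F 2 θ' h' ∧ w.C = (Node00.datumOfRecord₁₃SepCoPH F 2 θ h).C ∧ (0 < w.γ ∧ w.γ ≤ θ'.γ) ∧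
    w.L = (θ'.L : ℝ) ∧ ∀ P : B12.RunParams, w.up P = Node00.upOfRecord₅CS F 2 (θ'.toStage5₁₃CoPH F 2) P

/-- rung 0 (v6 l.110–111 VERBATIM): K0⁷'s conclusion on `F` — an admissible Stage-13 tuple with provisos and print's partition of unity ∕ slot non-degeneracy.
[cite: Balaban1988Convergent, Thm 1 p.262, (2.6)–(2.8) pp.255–256; Balaban1987RG1, Thm 1 p.259 (bookkeeping)] -/
def Inhabited13 (F : T4Family) : Prop :=
  ∃ θ : Node00.Stage13HParams F 2, θ.Provisos₁₃SepCoPH F 2 ∧ (θ.ZhUnity F 2 ∧ θ.SlotsNondegenerate₁₃ F 2) ∧ θ.Admissible F 2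

/-- rung 1 (v6 l.118–122 VERBATIM = v5 = v3.1): SOME unity Stage-13 tuple and an S-BOUND world of its datum of record all of whose runs' leaf worlds satisfy the thirteen DAG nodes, AND print's
[16] sentence `Node00.PrintedUV3V 2 θ.L` (Thm 1 p.257 compact + Thm 2 p.272), AND on every run that has steps the `rBasicStep` leaf the DAG reads IS [IV]'s basic step `B15Leaf` at NODE 00's
bundle of record read at a genuine step.  (= the conclusion of registered stub `stub_nodes13PWS` ∕ the hypothesis of `stub_runRows13PWS`.)
[cite: Balaban1989LargeFieldII, Thm 1 p.355 + p.391; Balaban1985UV3, Thm 1 p.257 + Thm 2 p.272; Balaban1989LargeFieldI, (0.4)–(0.6) p.176, Prop. 1 p.194; Balaban1987RG1, Thm 3 p.264 (bookkeeping)] -/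
def NodesAtSomeRecord13PWS (F : T4Family) : Prop :=
  ∃ (θ : Node00.Stage13HParams F 2) (h : θ.Provisos₁₃SepCoPH F 2) (w : WorldP), (θ.ZhUnity F 2 ∧ θ.SlotsNondegenerate₁₃ F 2) ∧ θ.Admissible F 2 ∧
    RecordS F θ h w ∧ (∀ P : B12.RunParams, Nodes (leavesP w P)) ∧ Node00.PrintedUV3V 2 θ.L ∧
    ∃ lam : Node00.ResidW F 2, (∀ P : B12.RunParams, 1 ≤ P.K → lam.kSel P < P.K) ∧
      ∀ P : B12.RunParams, lam.kSel P < P.K → ((leavesP w P).rBasicStep ↔ B15Leaf (Node00.WOfRecord₁₃ F 2 θ.toStage13Params lam P))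

/-- the non-vacuity window of the crux, a clause about `D.C` only (v6 l.125–126, with the skeleton's `abbrev SU2 := Matrix.specialUnitaryGroup (Fin 2) ℂ` inlined).
[cite: Balaban1988Convergent, (0.4) p.235; Balaban1987RG1, (0.17)–(0.20) pp.255–256 (bookkeeping)] -/
def Window {F : T4Family} (D : FiniteEpsData F (Matrix.specialUnitaryGroup (Fin 2) ℂ)) : Prop :=
  ∃ γ₁ : ℝ, 0 < γ₁ ∧ ∀ γ : ℝ, 0 < γ → γ ≤ γ₁ → ∃ P : B12.RunParams, 1 ≤ P.K ∧ (D.C P).flow.InInterval γ P.K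

/-- v5's rung 2 (v6 l.129–132 VERBATIM; ANNEX in v6 — NOT a registered stub's text since v6): all nodes, the β bounds in the interval at `γ₀ := w.γ` ([I] (1.22) p.264; pointwise floor
`w.b > 0` printed nowhere, T09.F), and the window at the datum of record.  Kept because the pointwise two-sided road remains a valid, STRONGER supplier of v6's rows
(`K1RunRowsOfBoxAndPartialSums.stub_runRows13PWS_of_stub_betaWindow13PWS`). [cite: Balaban1987RG1, §1 (1.22) p.264; Balaban1989LargeFieldII, Thm 1 p.355 (bookkeeping)] -/
def BetaWindowAtSomeRecord13S (F : T4Family) : Prop :=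
  ∃ (θ : Node00.Stage13HParams F 2) (h : θ.Provisos₁₃SepCoPH F 2) (w : WorldP), (θ.ZhUnity F 2 ∧ θ.SlotsNondegenerate₁₃ F 2) ∧ θ.Admissible F 2 ∧
    RecordS F θ h w ∧ (∀ P : B12.RunParams, Nodes (leavesP w P)) ∧
    BetaBoundsInInterval w.C.toB12 w.γ w.b w.βup ∧ Window (Node00.datumOfRecord₁₃SepCoPH F 2 θ h)

/-- rung 2″ (v6 l.155–160 VERBATIM, RUN CURRENCY): SOME unity Stage-13 tuple `θ` with provisos, an S-bound world `w` of its datum of record with the thirteen DAG nodes at every run, AND the RUN ROWS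
of `β_θ := Node00.betaOfRecord₁₃ F 2 θ.toStage13Params` that the END road of record reads: on SOME level `γ₀ > 0` — (i) DEF-1's RUN-WISE CONSTANT REMAINDER `RunConstRemainder β_θ b r γ₀` relative to
SOME reference sequence `b` ([I] Thm 3 p.264 with (1.22); (5.10) p.293; [II] (2.41) p.21), (ii) `∀ k, b k ≤ B`, (iii) the numeric CEILING MATCH `B + r ≤ w.βup`, (iv) the RUN-WISE PARTIAL-SUM FLOOR
`−M` along every solution of (0.20) up to `n` staying in `]0, γ₀]`.  `b r γ₀ B M` ∃-side.  (= the conclusion of registered stub `stub_runRows13PWS`.)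
[cite: Balaban1987RG1, Thm 3 p.264, (1.20)–(1.22) p.264, (5.10) p.293; Balaban1988RG2Cluster, (2.41) p.21 (bookkeeping)] -/
def RunRowsAtSomeRecord13PWS (F : T4Family) : Prop :=
  ∃ (θ : Node00.Stage13HParams F 2) (h : θ.Provisos₁₃SepCoPH F 2) (w : WorldP), (θ.ZhUnity F 2 ∧ θ.SlotsNondegenerate₁₃ F 2) ∧ θ.Admissible F 2 ∧
    RecordS F θ h w ∧ (∀ P : B12.RunParams, Nodes (leavesP w P)) ∧
    ∃ (b : ℕ → ℝ) (r γ₀ B M : ℝ), 0 < γ₀ ∧ RunConstRemainder (Node00.betaOfRecord₁₃ F 2 θ.toStage13Params) b r γ₀ ∧ (∀ k, b k ≤ B) ∧ B + r ≤ w.βup ∧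
      ∀ (n : ℕ) (gs : ℕ → ℝ), RGEqH n (Node00.betaOfRecord₁₃ F 2 θ.toStage13Params) gs → Step.InInterval γ₀ n gs →
        ∀ k, k ≤ n → -M ≤ ∑ j ∈ Finset.Ico k n, Node00.betaOfRecord₁₃ F 2 θ.toStage13Params j (prefixOf gs j)

/-! ## §2 The `Iff.rfl` bridges and the by-name compositions -/

/-- **`RecordS F θ h w` IS membership in dag-n10-d's S-class at the datum of record** (`Node00.recordS₁₃SepCoPH_iff`; `Iff.rfl`). [cite: Balaban1989LargeFieldII, Thm 1 + (0.1) pp.355–356 (bookkeeping)] -/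
theorem recordS_iff_isRecordOfRecord₁₃CSepCoPHS {F : T4Family} (θ : Node00.Stage13HParams F 2) (h : θ.Provisos₁₃SepCoPH F 2) (w : WorldP) :
    RecordS F θ h w ↔ Node00.IsRecordOfRecord₁₃CSepCoPHS F 2 (Node00.datumOfRecord₁₃SepCoPH F 2 θ h) w :=
  Iff.rfl

/-- sanity (kernel): K1⁷ is literally `∀ F, Inhabited13 F → ∃ θ h, (unity ∧ slots) ∧ Admissible ∧ (B) ∧ Window (datum)`. [cite: Balaban1989LargeFieldII, Thm 1 p.355 (bookkeeping)] -/
theorem stabilityBAtRecordR13SepCoPH_iff :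
    Summit.QuantumFields.YangMills.Theses.BalabanUVNodes.StabilityBAtRecordR13SepCoPH ↔
      ∀ F : T4Family, Inhabited13 F →
        ∃ (θ : Node00.Stage13HParams F 2) (h : θ.Provisos₁₃SepCoPH F 2), (θ.ZhUnity F 2 ∧ θ.SlotsNondegenerate₁₃ F 2) ∧ θ.Admissible F 2 ∧
          B16.EndStatementBPrinted (Node00.datumOfRecord₁₃SepCoPH F 2 θ h).C ∧ Window (Node00.datumOfRecord₁₃SepCoPH F 2 θ h) :=
  Iff.rfl

/-- **K1⁷ BY NAME FROM THE TWO v6 STUB TEXTS** (`h₁` = `stub_nodes13PWS`'s text, `h₂` = `stub_runRows13PWS`'s text): the skeleton's composition `StabilityBAtRecordR13SepCoPH_ofRunRows` over the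
named predicates — rows at the witness, then `K1EndOfNodes13PWSOfRunRemAt.stabilityB_body_of_rung1At_of_runLetters` (p598782 §2).  CONDITIONAL on the two texts (not proved here); K1⁷ OPEN.
[cite: Balaban1989LargeFieldII, Thm 1 p.355 + (0.1) pp.355–356 + p.391; Balaban1987RG1, Thm 3 p.264, (5.10) p.293; Balaban1988Convergent, (2.6) p.255, Cor. 3 (2.50) p.264 (bookkeeping)] -/
theorem stabilityBAtRecordR13SepCoPH_of_stubTexts
    (h₁ : ∀ F : T4Family, Inhabited13 F → NodesAtSomeRecord13PWS F)
    (h₂ : ∀ F : T4Family, NodesAtSomeRecord13PWS F → RunRowsAtSomeRecord13PWS F) :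
    Summit.QuantumFields.YangMills.Theses.BalabanUVNodes.StabilityBAtRecordR13SepCoPH := by
  intro F hinh
  obtain ⟨θ, h, w, hU, hθ, hR, hnodes, b, r, γ₀, B, M, hγ₀, hrem, hB, hmatch, hps⟩ := h₂ F (h₁ F hinh)
  exact ⟨θ, h, stabilityB_body_of_rung1At_of_runLetters θ h w hU hθ hR hnodes hγ₀ hrem hB hmatch hps⟩

/-- **K1⁷ BY NAME FROM STUB 1's TEXT AND v5's RUNG-2 TEXT** (the v6 ANNEX road `StabilityBAtRecordR13SepCoPH_of` over the named predicates): (B) by dag-n10-d's S-class headline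
`Node00.endStatementBPrinted_of_isRecordOfRecord₁₃CSepCoPHS_of_nodes` at `γ₀ := w.γ`, the window carried by the text.  CONDITIONAL; K1⁷ OPEN. [cite: Balaban1989LargeFieldII, Thm 1 p.355; Balaban1987RG1, §1 (1.22) p.264 (bookkeeping)] -/
theorem stabilityBAtRecordR13SepCoPH_of_stubTexts_v5annex
    (h₁ : ∀ F : T4Family, Inhabited13 F → NodesAtSomeRecord13PWS F)
    (h₂ : ∀ F : T4Family, NodesAtSomeRecord13PWS F → BetaWindowAtSomeRecord13S F) :
    Summit.QuantumFields.YangMills.Theses.BalabanUVNodes.StabilityBAtRecordR13SepCoPH := by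
  intro F hinh
  obtain ⟨θ, h, w, hU, hθ, hR, hnodes, hβ, hwin⟩ := h₂ F (h₁ F hinh)
  exact ⟨θ, h, hU, hθ, Node00.endStatementBPrinted_of_isRecordOfRecord₁₃CSepCoPHS_of_nodes ((recordS_iff_isRecordOfRecord₁₃CSepCoPHS θ h w).1 hR) le_rfl hnodes hβ, hwin⟩

/-- **v5's RUNG-2 TEXT ⟹ v6's RUNG-2″ TEXT, BY NAME** (this seat's `K1RunRowsOfBoxAndPartialSums.runRowsAt_of_rung2At`, p602861: `b :≡ (w.b+w.βup)∕2`, `r := (w.βup−w.b)∕2`, `γ₀ := w.γ`,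
`B + r = w.βup`, `M := 0` from `WorldP.b_pos`; the interval binder read along every (0.20)-solution by forward uniqueness).  So v6's rows are WEAKER than v5's binder and every supplier
of the pointwise two-sided road still serves. [cite: Balaban1987RG1, §1 (1.22) p.264, Thm 3 p.264 (bookkeeping)] -/
theorem runRowsAtSomeRecord13PWS_of_betaWindowAtSomeRecord13S (F : T4Family) (h : BetaWindowAtSomeRecord13S F) : RunRowsAtSomeRecord13PWS F := by
  obtain ⟨θ, hP, w, hU, hθ, hR, hnodes, hβ, -⟩ := h
  exact runRowsAt_of_rung2At θ hP w hU hθ hR hnodes hβ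

/-- **v5's STUB-2 TEXT ⟹ v6's STUB-2″ TEXT, BY NAME** (the v5 annex of the skeleton, kernel). [cite: Balaban1987RG1, §1 (1.22) p.264 (bookkeeping)] -/
theorem stub_runRows13PWS_of_stub_betaWindow13PWS (h₂ : ∀ F : T4Family, NodesAtSomeRecord13PWS F → BetaWindowAtSomeRecord13S F) :
    ∀ F : T4Family, NodesAtSomeRecord13PWS F → RunRowsAtSomeRecord13PWS F :=
  fun F h₁ => runRowsAtSomeRecord13PWS_of_betaWindowAtSomeRecord13S F (h₂ F h₁)

/-! ## §3 The skeleton's displayed adapter from K2⁷ v6's run letter, over the named predicate -/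

/-- **ADAPTER (v6 l.174–184 VERBATIM over the named predicates): K2⁷ v6's RUN LETTER + THE (D1) DRIFT + THE MATCH ⟹ v6's RUN ROWS.**  At rung-1 data `(θ, h, w)`: DEF-1's `RunRemAt F κ θ h c`
(remainder conjunct `RunConstRemainder (datum).βfun (c • beta0OfJs F κ) s γ₀`, cap `s ≤ c·stepBal 2 F.L`; anchor and `SurvCont` UNREAD), the bare drift rescaled by `oneLoopDrift_const_mul`, band
`c·b_k ≤ c·stepBal 2 F.L + 2|c|A` (`band_of_drift`), run-wise (PS) (`runwisePS_of_drift_runConstRemainder`), and the numeric match `2c·stepBal 2 F.L + 2|c|A ≤ w.βup`.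
[cite: Balaban1987RG1, Thm 3 p.264, (1.20)–(1.22) p.264, (2.12)–(2.14) p.268, (5.10) p.293 (bookkeeping)] -/
theorem runRowsAtSomeRecord13PWS_of_runRemAt_drift_match {F : T4Family} (θ : Node00.Stage13HParams F 2) (h : θ.Provisos₁₃SepCoPH F 2) (w : WorldP)
    (hU : θ.ZhUnity F 2 ∧ θ.SlotsNondegenerate₁₃ F 2) (hθ : θ.Admissible F 2) (hR : RecordS F θ h w) (hnodes : ∀ P : B12.RunParams, Nodes (leavesP w P))
    (κ : StepColourData) {c A : ℝ} (hRun : RunRemAt F κ θ h c) (hdrift : OneLoopDrift (B12Normalization.stepBal 2 F.L) A (beta0OfJs F κ))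
    (hmatch : 2 * (c * B12Normalization.stepBal 2 F.L) + 2 * (|c| * A) ≤ w.βup) : RunRowsAtSomeRecord13PWS F := by
  obtain ⟨γ₀, s, hγ₀, -, hcap, hrem, -, -⟩ := hRun
  have hd := oneLoopDrift_const_mul hdrift c
  have hband : ∀ k, c * beta0OfJs F κ k ≤ c * B12Normalization.stepBal 2 F.L + 2 * (|c| * A) := fun k => by
    have := (abs_le.mp (band_of_drift hd k)).2
    linarith
  have hmatch' : c * B12Normalization.stepBal 2 F.L + 2 * (|c| * A) + s ≤ w.βup := by linarith
  exact ⟨θ, h, w, hU, hθ, hR, hnodes, fun k => c * beta0OfJs F κ k, s, γ₀, _, _, hγ₀, hrem, hband, hmatch', runwisePS_of_drift_runConstRemainder hd hrem hcap⟩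

end Summit.QuantumFields.YangMills.Theorems.K1V6Defs

end
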